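import Summits.AtomisticToContinuum.HydrodynamicLimit.Theses.AntiMazurCoboundaries
import Literature.MathematicalPhysics.KineticTheory.HardSphereEulerProofs
import Summits.AtomisticToContinuum.HydrodynamicLimit.Theorems.AntiMazurCoboundariesShearStressHalfDrudeDiluteCorner

/-!
# `ShearStressHalfDrude` (stmt-AtomisticToContinuum-14136), line `cutoff-compactness-net`:
# sub-stub W10 `stub_cutoffGaussianSize` — Gaussian size of the cutoff stresses at the slow end

For unit orthogonal directions `e₁ ⊥ e₂` and a cutoff scale `0 < A ≤ 1`, the cutoff shear stress
`g(w) = ⟪e₁,w⟫⟪e₂,w⟫(1 - smoothTransition (‖w‖²/A² - 1))` satisfies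
`c·A⁷ ≤ ∫ g² dγ ≤ C·A⁷` (`γ = stdGaussian V3`) with constants `c, C > 0` independent of `(e₁, e₂, A)`,
together with the pointwise facts `|g| ≤ 2A²` and `g = 0` off `‖w‖² < 2A²`.

Proof. Write `∫ · dγ = ∫ M(v) · dv` with the global Maxwellian `M(v) = M(0) e^{-‖v‖²/2}`
(`integral_stdGaussian_eq_integral_mul_globalMaxwellian`).
* Upper bound: `g² ≤ (2A²)²` and `g = 0` off the closed ball of radius `2A`, `M ≤ M(0)`, so
  `∫ M g² ≤ 4A⁴ · M(0) · vol(closedBall 0 (2A)) = 32 · M(0) · vol(B₁) · A⁷`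
  (`Measure.addHaar_real_closedBall`, `finrank V3 = 3`).
* Lower bound: on the closed ball `B = closedBall ((A/2)(e₁+e₂)) (A/8)` one has `⟪eᵢ,w⟫ ≥ 3A/8`,
  `‖w‖ ≤ 7A/8 ≤ A` (so the cutoff factor is `1` and `M(w) ≥ M(0)e^{-1/2}`), whence
  `∫ M g² ≥ ∫_B M g² ≥ (3A/8)⁴ · M(0) e^{-1/2} · (A/8)³ vol(B₁)`.
No rotation invariance and no change of variables is needed; Mathlib only, plus the tree's
`globalMaxwellian` bridge and the landed cutoff lemmas of `ShearStressHalfDrudeDiluteCorner`.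
-/

namespace Summit.AtomisticToContinuum.HydrodynamicLimit.Theorems

namespace ShearStressHalfDrudeGaussianSize

open MeasureTheory ProbabilityTheory Filter Set
open scoped ENNReal InnerProductSpace BigOperators
open Literature.Analysis.FluidPDE Literature.MathematicalPhysics.KineticTheory
open ShearStressHalfDrudeDiluteCorner (continuous_cutoff cutoff_eq_zero_of_le abs_cutoff_le
  hasCompactSupport_cutoff)

/-! ## Two small facts: the Maxwellian factorisation and the volume of balls in `V3` -/

/-- `M(w) = M(0) · e^{-‖w‖²/2}`. [folklore] -/
theorem globalMaxwellian_eq_mul_exp (w : V3) :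
    globalMaxwellian w = globalMaxwellian (0 : V3) * Real.exp (-‖w‖ ^ 2 / 2) := by
  simp [globalMaxwellian]

/-- Volume of closed balls in `V3 = ℝ³`: `vol(closedBall x r) = r³ · vol(B₁)`. [folklore] -/
theorem volume_real_closedBall (x : V3) {r : ℝ} (hr : 0 ≤ r) :
    volume.real (Metric.closedBall x r) = r ^ 3 * volume.real (Metric.ball (0 : V3) 1) := by
  rw [Measure.addHaar_real_closedBall volume x hr, finrank_euclideanSpace_fin]

/-! ## Integrability of `M g²` -/

/-- `M · g²` is continuous, compactly supported, nonnegative, hence Lebesgue integrable. [folklore] -/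
theorem integrable_globalMaxwellian_mul_sq {e₁ e₂ : V3} {A : ℝ} (hA : 0 < A) {g : V3 → ℝ}
    (hg : g = fun w => inner ℝ e₁ w * inner ℝ e₂ w * (1 - Real.smoothTransition (‖w‖ ^ 2 / A ^ 2 - 1))) :
    Integrable (fun v : V3 => globalMaxwellian v * g v ^ 2) := by
  have hgc : Continuous g := by rw [hg]; exact continuous_cutoff e₁ e₂ A
  have hgs : HasCompactSupport g := by rw [hg]; exact hasCompactSupport_cutoff e₁ e₂ hA
  have hc : Continuous fun v : V3 => globalMaxwellian v * g v ^ 2 :=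
    continuous_globalMaxwellian.mul (hgc.pow 2)
  have hs : HasCompactSupport fun v : V3 => globalMaxwellian v * g v ^ 2 :=
    hgs.mono fun v hv => by
      simp only [Function.mem_support, ne_eq] at hv ⊢
      intro hv0
      exact hv (by rw [hv0]; ring)
  exact hc.integrable_of_hasCompactSupport hs

/-! ## The upper bound `∫ g² dγ ≤ C A⁷` -/

/-- **Upper bound.** `∫ g² dγ ≤ 32 · M(0) · vol(B₁) · A⁷` for unit directions: `g² ≤ 4A⁴` on its support,
which lies in the closed ball of radius `2A`, and `M ≤ M(0)`. [folklore] -/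
theorem integral_sq_le {e₁ e₂ : V3} (h1 : ‖e₁‖ = 1) (h2 : ‖e₂‖ = 1) {A : ℝ} (hA : 0 < A)
    {g : V3 → ℝ}
    (hg : g = fun w => inner ℝ e₁ w * inner ℝ e₂ w * (1 - Real.smoothTransition (‖w‖ ^ 2 / A ^ 2 - 1))) :
    ∫ v, g v ^ 2 ∂stdGaussian V3 ≤
      32 * globalMaxwellian (0 : V3) * volume.real (Metric.ball (0 : V3) 1) * A ^ 7 := by
  rw [integral_stdGaussian_eq_integral_mul_globalMaxwellian]
  have hzero : ∀ v, v ∉ Metric.closedBall (0 : V3) (2 * A) → globalMaxwellian v * g v ^ 2 = 0 := by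
    intro v hv
    rw [Metric.mem_closedBall, dist_zero_right, not_le] at hv
    have h2A : (2 * A) ^ 2 < ‖v‖ ^ 2 := pow_lt_pow_left₀ hv (by positivity) two_ne_zero
    have hgv : g v = 0 := by
      rw [hg]
      exact cutoff_eq_zero_of_le hA (by nlinarith [sq_nonneg A])
    rw [hgv]
    ring
  rw [← setIntegral_eq_integral_of_forall_compl_eq_zero hzero]
  have hbound : ∀ v ∈ Metric.closedBall (0 : V3) (2 * A),
      ‖globalMaxwellian v * g v ^ 2‖ ≤ globalMaxwellian (0 : V3) * (2 * A ^ 2) ^ 2 := by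
    intro v _
    rw [Real.norm_of_nonneg (mul_nonneg (globalMaxwellian_pos v).le (sq_nonneg _))]
    have hMv : globalMaxwellian v ≤ globalMaxwellian (0 : V3) := by
      rw [globalMaxwellian_eq_mul_exp v]
      refine mul_le_of_le_one_right (globalMaxwellian_pos _).le (Real.exp_le_one_iff.2 ?_)
      rw [neg_div]
      exact neg_nonpos.2 (by positivity)
    refine mul_le_mul hMv ?_ (sq_nonneg _) (globalMaxwellian_pos _).le
    have hab : |g v| ≤ 2 * A ^ 2 := by
      have := abs_cutoff_le e₁ e₂ hA v
      rw [h1, h2, mul_one, mul_one] at this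
      rw [hg]
      exact this
    calc g v ^ 2 = |g v| ^ 2 := (sq_abs _).symm
      _ ≤ (2 * A ^ 2) ^ 2 := pow_le_pow_left₀ (abs_nonneg _) hab 2
  calc ∫ v in Metric.closedBall (0 : V3) (2 * A), globalMaxwellian v * g v ^ 2
      ≤ ‖∫ v in Metric.closedBall (0 : V3) (2 * A), globalMaxwellian v * g v ^ 2‖ := Real.le_norm_self _
    _ ≤ globalMaxwellian (0 : V3) * (2 * A ^ 2) ^ 2 * volume.real (Metric.closedBall (0 : V3) (2 * A)) :=
      norm_setIntegral_le_of_norm_le_const measure_closedBall_lt_top hbound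
    _ = 32 * globalMaxwellian (0 : V3) * volume.real (Metric.ball (0 : V3) 1) * A ^ 7 := by
      rw [volume_real_closedBall 0 (by positivity)]
      ring

/-! ## The lower bound `c A⁷ ≤ ∫ g² dγ` -/

/-- **Lower bound.** `(3/8)⁴ (1/8)³ e^{-1/2} · M(0) · vol(B₁) · A⁷ ≤ ∫ g² dγ` for unit orthogonal directions
and `0 < A ≤ 1`: on the closed ball of radius `A/8` about `(A/2)(e₁ + e₂)` the cutoff is inactive,
`⟪eᵢ, w⟫ ≥ 3A/8` and `M(w) ≥ M(0)e^{-1/2}`. [folklore] -/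
theorem le_integral_sq {e₁ e₂ : V3} (h1 : ‖e₁‖ = 1) (h2 : ‖e₂‖ = 1) (he : inner ℝ e₁ e₂ = 0)
    {A : ℝ} (hA : 0 < A) (hA1 : A ≤ 1) {g : V3 → ℝ}
    (hg : g = fun w => inner ℝ e₁ w * inner ℝ e₂ w * (1 - Real.smoothTransition (‖w‖ ^ 2 / A ^ 2 - 1))) :
    (3 / 8) ^ 4 * (1 / 8) ^ 3 * Real.exp (-1 / 2) * globalMaxwellian (0 : V3) *
        volume.real (Metric.ball (0 : V3) 1) * A ^ 7 ≤ ∫ v, g v ^ 2 ∂stdGaussian V3 := by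
  rw [integral_stdGaussian_eq_integral_mul_globalMaxwellian]
  have hFi := integrable_globalMaxwellian_mul_sq hA hg
  have he' : ⟪e₂, e₁⟫_ℝ = 0 := by rw [real_inner_comm]; exact he
  obtain ⟨y, hy⟩ : ∃ y : V3, y = (A / 2) • (e₁ + e₂) := ⟨_, rfl⟩
  have hy1 : ⟪e₁, y⟫_ℝ = A / 2 := by
    rw [hy, inner_smul_right, inner_add_right, real_inner_self_eq_norm_sq, h1, he]
    ring
  have hy2 : ⟪e₂, y⟫_ℝ = A / 2 := by
    rw [hy, inner_smul_right, inner_add_right, real_inner_self_eq_norm_sq, h2, he']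
    ring
  have hsum : ‖e₁ + e₂‖ ≤ 3 / 2 := by
    have hsq : ‖e₁ + e₂‖ ^ 2 = 2 := by
      rw [norm_add_sq_real, h1, h2, he]
      ring
    nlinarith [norm_nonneg (e₁ + e₂)]
  have hyn : ‖y‖ ≤ 3 * A / 4 := by
    rw [hy, norm_smul, Real.norm_eq_abs, abs_of_pos (by positivity)]
    calc A / 2 * ‖e₁ + e₂‖ ≤ A / 2 * (3 / 2) := by gcongr
      _ = 3 * A / 4 := by ring
  -- the pointwise lower bound on the small ball
  have hpt : ∀ w ∈ Metric.closedBall y (A / 8),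
      globalMaxwellian (0 : V3) * Real.exp (-1 / 2) * (3 * A / 8) ^ 4 ≤
        globalMaxwellian w * g w ^ 2 := by
    intro w hw
    rw [mem_closedBall_iff_norm] at hw
    have hwn : ‖w‖ ≤ A := by
      have := norm_sub_norm_le w y
      linarith
    have hw2 : ‖w‖ ^ 2 ≤ A ^ 2 := pow_le_pow_left₀ (norm_nonneg _) hwn 2
    have hw1 : ‖w‖ ^ 2 ≤ 1 := hw2.trans (pow_le_one₀ hA.le hA1)
    have hi1 : 3 * A / 8 ≤ ⟪e₁, w⟫_ℝ := by
      have h := abs_real_inner_le_norm e₁ (w - y)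
      rw [inner_sub_right, h1, one_mul, abs_le] at h
      linarith [h.1]
    have hi2 : 3 * A / 8 ≤ ⟪e₂, w⟫_ℝ := by
      have h := abs_real_inner_le_norm e₂ (w - y)
      rw [inner_sub_right, h2, one_mul, abs_le] at h
      linarith [h.1]
    have h0 : ‖w‖ ^ 2 / A ^ 2 - 1 ≤ 0 := by
      rw [sub_nonpos, div_le_one (by positivity)]
      exact hw2
    have hgw : g w = ⟪e₁, w⟫_ℝ * ⟪e₂, w⟫_ℝ := by
      rw [hg]
      show inner ℝ e₁ w * inner ℝ e₂ w * (1 - Real.smoothTransition (‖w‖ ^ 2 / A ^ 2 - 1)) = _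
      rw [Real.smoothTransition.zero_of_nonpos h0]
      ring
    have hprod : 3 * A / 8 * (3 * A / 8) ≤ g w := by
      rw [hgw]
      exact mul_le_mul hi1 hi2 (by positivity) ((by positivity : (0 : ℝ) ≤ 3 * A / 8).trans hi1)
    have hsq : (3 * A / 8) ^ 4 ≤ g w ^ 2 := by
      calc (3 * A / 8) ^ 4 = (3 * A / 8 * (3 * A / 8)) ^ 2 := by ring
        _ ≤ g w ^ 2 := pow_le_pow_left₀ (by positivity) hprod 2
    have hMw : globalMaxwellian (0 : V3) * Real.exp (-1 / 2) ≤ globalMaxwellian w := by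
      rw [globalMaxwellian_eq_mul_exp w]
      refine mul_le_mul_of_nonneg_left (Real.exp_le_exp.2 ?_) (globalMaxwellian_pos _).le
      rw [neg_div, neg_div, neg_le_neg_iff]
      linarith
    exact mul_le_mul hMw hsq (by positivity) (globalMaxwellian_pos w).le
  have hFnn : 0 ≤ᵐ[volume] fun v : V3 => globalMaxwellian v * g v ^ 2 :=
    Eventually.of_forall fun v => mul_nonneg (globalMaxwellian_pos v).le (sq_nonneg _)
  calc (3 / 8) ^ 4 * (1 / 8) ^ 3 * Real.exp (-1 / 2) * globalMaxwellian (0 : V3) *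
        volume.real (Metric.ball (0 : V3) 1) * A ^ 7
      = globalMaxwellian (0 : V3) * Real.exp (-1 / 2) * (3 * A / 8) ^ 4 *
          volume.real (Metric.closedBall y (A / 8)) := by
        rw [volume_real_closedBall y (by positivity)]
        ring
    _ ≤ ∫ v in Metric.closedBall y (A / 8), globalMaxwellian v * g v ^ 2 :=
        setIntegral_ge_of_const_le_real measurableSet_closedBall measure_closedBall_lt_top.ne hpt
          hFi.integrableOn
    _ ≤ ∫ v, globalMaxwellian v * g v ^ 2 := setIntegral_le_integral hFi hFnn

/-! ## The registered sub-stub -/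

/-- **W10 `stub_cutoffGaussianSize`** (line `cutoff-compactness-net` of `ShearStressHalfDrude`,
stmt-AtomisticToContinuum-14136): Gaussian size of the cutoff stresses at the slow end. There are
constants `0 < c ≤ C` such that for all unit orthogonal directions `e₁ ⊥ e₂` and all `0 < A ≤ 1` the
cutoff stress `g = g_{e₁,e₂,A}` has `c·A⁷ ≤ ‖g‖²_γ ≤ C·A⁷`, `‖g‖_∞ ≤ 2A²`, and `g = 0` off `‖w‖² < 2A²`.
Explicitly `c = (3/8)⁴ 8⁻³ e^{-1/2} M(0) vol(B₁)` and `C = 32 M(0) vol(B₁)` with `M(0) = (2π)^{-3/2}`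
and `B₁` the unit ball of `ℝ³`. -/
theorem stub_cutoffGaussianSize :
    ∃ c : ℝ, 0 < c ∧ ∃ C : ℝ, 0 < C ∧ ∀ (e₁ e₂ : V3), ‖e₁‖ = 1 → ‖e₂‖ = 1 → inner ℝ e₁ e₂ = 0 →
    ∀ A : ℝ, 0 < A → A ≤ 1 →
    ∀ g : V3 → ℝ, (g = fun w => inner ℝ e₁ w * inner ℝ e₂ w * (1 - Real.smoothTransition (‖w‖ ^ 2 / A ^ 2 - 1))) →
      c * A ^ 7 ≤ ∫ v, g v ^ 2 ∂stdGaussian V3 ∧ ∫ v, g v ^ 2 ∂stdGaussian V3 ≤ C * A ^ 7 ∧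
      ∀ w, |g w| ≤ 2 * A ^ 2 ∧ (2 * A ^ 2 ≤ ‖w‖ ^ 2 → g w = 0) := by
  have hM := globalMaxwellian_pos (0 : V3)
  have hB : 0 < volume.real (Metric.ball (0 : V3) 1) := by
    rw [measureReal_def]
    exact ENNReal.toReal_pos (Metric.measure_ball_pos volume (0 : V3) one_pos).ne'
      measure_ball_lt_top.ne
  refine ⟨(3 / 8) ^ 4 * (1 / 8) ^ 3 * Real.exp (-1 / 2) * globalMaxwellian (0 : V3) *
      volume.real (Metric.ball (0 : V3) 1), by positivity,
    32 * globalMaxwellian (0 : V3) * volume.real (Metric.ball (0 : V3) 1), by positivity, ?_⟩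
  intro e₁ e₂ h1 h2 he A hA hA1 g hg
  refine ⟨le_integral_sq h1 h2 he hA hA1 hg, integral_sq_le h1 h2 hA hg, fun w => ⟨?_, fun hw => ?_⟩⟩
  · have := abs_cutoff_le e₁ e₂ hA w
    rw [h1, h2, mul_one, mul_one] at this
    rw [hg]
    exact this
  · rw [hg]
    exact cutoff_eq_zero_of_le hA hw

end ShearStressHalfDrudeGaussianSize

end Summit.AtomisticToContinuum.HydrodynamicLimit.Theorems
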